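import Literature.NumberTheory.Weil1964.AdelicDoublingDefectCharacter
import Literature.NumberTheory.Weil1964.AdelicMetaplecticRationalLiftIsometric
import Literature.NumberTheory.Weil1964.AdelicMetaplecticProjSurjective
import Literature.NumberTheory.Automorphic.AdeleRingSymplecticPerfect
import HarnessLib

/-!
# The doubling defect character is the inverse `L²` scaling: `doublingDefectChar x = (l2Scaling x)⁻¹`;
# in particular the doubling lift restricted to the diagonal IS `ω ⊗ ω̄` on `L²`-isometric implementers

Topic `NumberTheory/Weil1964`; namespace `Literature.NumberTheory.Weil1964`.  KERNEL MATHEMATICS ONLY (theorems; no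
definition, no named fact, no proof hole).  Sequel of `AdelicDoublingDefectCharacter` (the HOMOMORPHISM
`χ = doublingDefectChar F T hT : Mp_ψ(W_𝔸)ᶜᵒⁿᵗ →* ℂˣ` with `ω(S̃(π x)) (Φ₁ ⊠ Ψ₂) = χ(x) • (ω(x) Φ₁ ⊠ ω_{−T}(xᶜ) Ψ₂)`).

THE STATEMENT.  [Kudla1994, Thm. 3.1]∕[HarrisKudlaSweet1996, §1]: the metaplectic splittings over a unitary group attached
to characters `χ_W` are multiplicative in orthogonal sums of `W`; for the DOUBLE `W ⊕ W⁻` this gives `χ_W χ_W⁻¹ = 1`, i.e. on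
the diagonal the canonical (Siegel-parabolic) lift of the doubled space restricts to `ω ⊗ ω̄` — [Li1992, p. 181]: «`ω ⊗ ω*`
… is the restriction of `ω□`».  In the tree's model-free currency this is the triviality of the defect character on
UNITARY (`L²`-isometric) implementers, and we prove the sharper CLOSED FORM

  **`(doublingDefectChar F T hT x : ℂ) = ((l2Scaling F T hT ν x).toReal : ℂ)⁻¹`**   for every `x ∈ Mp_ψ(W_𝔸)ᶜᵒⁿᵗ`

(`doublingDefectChar_coe_eq_inv_l2Scaling`), where `l2Scaling ν x ∈ (0, ∞)` is the tree's `L²(ν)` scaling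
(`∫⁻ ‖ω(x)Φ‖ₑ² dν = l2Scaling ν x · ∫⁻ ‖Φ‖ₑ² dν`, ★ `AdelicMetaplecticUnitaryLegContinuity`).  PROOF (group theory, no
cocycles): `φ := χ · l2Scaling : Mp_ψ(W_𝔸)ᶜᵒⁿᵗ →* ℂˣ` kills the kernel of `π` — on a central `(1, t·id)` the three operators
are `1`, `t`, `t̄`, so `χ = (t t̄)⁻¹` (`doublingDefectChar_ofScalar`) while `l2Scaling = |t|²` (`l2Scaling_ofScalar`) —, hence
factors through the SURJECTION `π : Mp_ψ(W_𝔸)ᶜᵒⁿᵗ → Sp(W_𝔸)` (★ `adelicMpCont.proj_surjective`,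
★ `adelicMpCont.exists_eq_ofScalar_of_proj_eq_one`), hence is trivial because **`Sp(W_𝔸)` has no characters**
(★ `Automorphic.monoidHom_eq_one_of_factors_through_symplecticGroup_adeleRing_gram`, `AdeleRingSymplecticPerfect`).

* §1 the centre: `doublingDefectChar_ofScalar`, `l2Scaling_ofScalar`;
* §2 `doublingDefectChar_mul_l2Scaling_eq_one`, **`doublingDefectChar_coe_eq_inv_l2Scaling`**,
  **`doublingDefectChar_eq_one_of_l2Scaling_eq_one`**, and the `hiso`-form
  **`doublingDefectChar_eq_one_of_lintegral_eq`** (`∀ Φ, ∫⁻ ‖ω(x)Φ‖ₑ² = ∫⁻ ‖Φ‖ₑ²` ⇒ `χ(x) = 1`) — the input «SW0» of the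
  Siegel–Weil sub-line of the E-2 engine (crux H413): along a compatible splitting with unitary operators the diagonal
  see-saw identity of `RallisDiagonalSeesaw` is TWIST-FREE.

## References
* [Kudla1994] S. Kudla, Israel J. Math. 87 (1994) 361–401, Thm. 3.1 (splittings and their characters).
* [HarrisKudlaSweet1996] M. Harris, S. Kudla, W. J. Sweet, J. AMS 9 (1996), §1 (1.2)–(1.8).
* [Li1992] J.-S. Li, J. reine angew. Math. 428 (1992), p. 181.
* [MoeglinVignerasWaldspurger1987] C. Mœglin, M.-F. Vignéras, J.-L. Waldspurger, LNM 1291 (1987), Chap. 2 II.1 (B).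
* [Weil1964] A. Weil, Acta Math. 111 (1964), Chap. I n° 13 p. 160, Chap. III n° 37–38.
-/

noncomputable section

open _root_.MeasureTheory NumberField
open scoped ComplexConjugate ENNReal

namespace Literature.NumberTheory.Weil1964

open Literature.RepresentationTheory.HeisenbergGroup Literature.NumberTheory.Automorphic

section Trivial

variable (F : Type) [Field F] [NumberField F] {n : ℕ}
variable (T : Matrix (Fin n) (Fin n) (AdeleRing (𝓞 F) F)) (hT : IsUnit T.det)
variable [MeasurableSpace (AdeleRing (𝓞 F) F)] [BorelSpace (AdeleRing (𝓞 F) F)]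
  (ν : Measure (Fin n → AdeleRing (𝓞 F) F)) [ν.IsAddHaarMeasure]

/-! ## §1 The centre: `χ(1, t) = (t t̄)⁻¹`, `l2Scaling (1, t) = |t|²` -/

omit [MeasurableSpace (AdeleRing (𝓞 F) F)] [BorelSpace (AdeleRing (𝓞 F) F)] in
/-- the doubling lift kills the centre: `S̃(π (1, t)) = S̃(1) = 1`. [cite: Weil1964, Chap. III n° 37 p. 188] -/
theorem doublingLiftMp_ofScalar (t : ℂˣ) :
    doublingLiftMp F T hT (adelicMpCont.ofScalar F (Fin n) T t) = 1 :=
  (congrArg (doublingLift F T hT) (adelicMpCont.proj_ofScalar (F := F) (ι := Fin n) (T := T) t)).trans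
    (map_one (doublingLift F T hT))

omit [MeasurableSpace (AdeleRing (𝓞 F) F)] [BorelSpace (AdeleRing (𝓞 F) F)] in
/-- **the defect character on the centre**: `χ(1, t·id) = (t t̄)⁻¹` — the three operators of the see-saw triple at a central
element are `ω(S̃(1)) = 1`, `ω(1,t) = t`, `ω_{−T}((1,t)ᶜ) = C t C = t̄`. [cite: MoeglinVignerasWaldspurger1987, Chap. 2 II.1 (B)] -/
theorem doublingDefectChar_ofScalar (t : ℂˣ) :
    (doublingDefectChar F T hT (adelicMpCont.ofScalar F (Fin n) T t) : ℂ) = ((t : ℂ) * conj (t : ℂ))⁻¹ := by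
  refine coe_mpSeesawChar_eq
    (sumSeesawSplitting finSumFinEquiv.symm (reindex_symm_doubledGramFin F T) (doublingLiftMp F T hT))
    (MonoidHom.id _) (conjMp F T)
    (proj_sumSeesawSplitting finSumFinEquiv.symm (reindex_symm_doubledGramFin F T) (doublingLiftMp F T hT)
      (MonoidHom.id _) (conjMp F T) (spReindex_proj_doublingLiftMp F T hT))
    ((Matrix.isUnit_iff_isUnit_det T).mpr hT) ((Matrix.isUnit_iff_isUnit_det T).mpr hT).neg fun Φ₁ Φ₂ => ?_
  -- left: `ω(sumTransport (S̃ π (1,t))) (Φ₁ ⊠ Φ₂) = R_e (ω(1) (R_e⁻¹ (Φ₁ ⊠ Φ₂))) = Φ₁ ⊠ Φ₂`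
  have hL : adelicMpCont.omega F (Fin n ⊕ Fin n) (Matrix.fromBlocks T 0 0 (-T))
        (sumSeesawSplitting finSumFinEquiv.symm (reindex_symm_doubledGramFin F T) (doublingLiftMp F T hT)
          (adelicMpCont.ofScalar F (Fin n) T t)) (tensorToSum F (Fin n) (Fin n) Φ₁ Φ₂) =
      tensorToSum F (Fin n) (Fin n) Φ₁ Φ₂ := by
    refine (omega_sumSeesawSplitting_apply finSumFinEquiv.symm (reindex_symm_doubledGramFin F T)
      (doublingLiftMp F T hT) (adelicMpCont.ofScalar F (Fin n) T t) (tensorToSum F (Fin n) (Fin n) Φ₁ Φ₂)).trans ?_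
    refine (congrArg (fun y : adelicMpCont F (Fin (n + n)) (doubledGramFin F T) =>
      piSBReindex F finSumFinEquiv.symm (adelicMpCont.omega F (Fin (n + n)) (doubledGramFin F T) y
        ((piSBReindex F finSumFinEquiv.symm).symm (tensorToSum F (Fin n) (Fin n) Φ₁ Φ₂))))
      (doublingLiftMp_ofScalar F T hT t)).trans ?_
    exact (congrArg (piSBReindex F finSumFinEquiv.symm) (adelicMpCont.omega_one_apply F (doubledGramFin F T) _)).trans
      ((piSBReindex F finSumFinEquiv.symm).apply_symm_apply _)
  -- right: `ω(1,t) Φ₁ = t Φ₁`, `ω_{−T}((1,t)ᶜ) Φ₂ = C (t • C Φ₂) = t̄ Φ₂`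
  have hR₁ : adelicMpCont.omega F (Fin n) T ((MonoidHom.id _) (adelicMpCont.ofScalar F (Fin n) T t)) Φ₁ = (t : ℂ) • Φ₁ :=
    adelicMpCont.omega_ofScalar t Φ₁
  have hR₂ : adelicMpCont.omega F (Fin n) (-T) (conjMp F T (adelicMpCont.ofScalar F (Fin n) T t)) Φ₂ = conj (t : ℂ) • Φ₂ :=
    (adelicMpCont.omega_adelicMpContConj_apply (adelicMpCont.ofScalar F (Fin n) T t) Φ₂).trans
      ((congrArg (piSchwartzBruhatConj F (Fin n)) (adelicMpCont.omega_ofScalar t (piSchwartzBruhatConj F (Fin n) Φ₂))).trans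
        ((LinearEquiv.map_smulₛₗ (piSchwartzBruhatConj F (Fin n)) (t : ℂ) (piSchwartzBruhatConj F (Fin n) Φ₂)).trans
          (congrArg ((starRingEnd ℂ) (t : ℂ) • ·) (piSchwartzBruhatConj_piSchwartzBruhatConj Φ₂))))
  have ht : ((t : ℂ) * conj (t : ℂ)) ≠ 0 := mul_ne_zero t.ne_zero ((map_ne_zero _).2 t.ne_zero)
  -- the scalar bookkeeping on `𝒮(𝔸^{n ⊕ n})` (no metaplectic carriers left)
  have hR : ((t : ℂ) * conj (t : ℂ))⁻¹ • tensorToSum F (Fin n) (Fin n) ((t : ℂ) • Φ₁) (conj (t : ℂ) • Φ₂) =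
      tensorToSum F (Fin n) (Fin n) Φ₁ Φ₂ := by
    rw [LinearMap.map_smul₂, map_smul, smul_smul, smul_smul, mul_assoc, inv_mul_cancel₀ ht, one_smul]
  exact hL.trans ((congrArg₂ (fun A B => ((t : ℂ) * conj (t : ℂ))⁻¹ • tensorToSum F (Fin n) (Fin n) A B) hR₁ hR₂).trans
    hR).symm

include hT in
/-- **the `L²` scaling on the centre**: `l2Scaling ν (1, t·id) = |t|²`. [cite: Weil1964, Chap. I n° 13 p. 160] -/
theorem l2Scaling_ofScalar (t : ℂˣ) :
    adelicMpCont.l2Scaling F T hT ν (adelicMpCont.ofScalar F (Fin n) T t) = ‖(t : ℂ)‖ₑ ^ 2 := by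
  refine adelicMpCont.l2Scaling_eq_of_forall F T hT ν _ fun Φ => ?_
  have h1 : (((adelicMpCont.omega F (Fin n) T (adelicMpCont.ofScalar F (Fin n) T t) Φ : piSchwartzBruhat F (Fin n)) :
      (Fin n → AdeleRing (𝓞 F) F) → ℂ)) = fun x => (t : ℂ) * (Φ : (Fin n → AdeleRing (𝓞 F) F) → ℂ) x := by
    rw [adelicMpCont.omega_ofScalar, Submodule.coe_smul]
    rfl
  rw [h1]
  simp_rw [enorm_mul, mul_pow]
  rw [lintegral_const_mul' _ _ (ENNReal.pow_ne_top enorm_ne_top)]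

/-! ## §2 `χ · l2Scaling` kills the centre, factors through `Sp(W_𝔸)`, hence is trivial -/

include hT in
/-- `(l2Scaling ν x).toReal ≠ 0`. [cite: Weil1964, Chap. I n° 13 p. 160] -/
private theorem l2Scaling_toReal_ne_zero (x : adelicMpCont F (Fin n) T) :
    ((adelicMpCont.l2Scaling F T hT ν x).toReal : ℂ) ≠ 0 :=
  Complex.ofReal_ne_zero.2 (ENNReal.toReal_ne_zero.2
    ⟨adelicMpCont.l2Scaling_ne_zero F T hT ν x, adelicMpCont.l2Scaling_ne_top F T hT ν x⟩)

/-- **`χ(x) · l2Scaling(x) = 1` for every `x ∈ Mp_ψ(W_𝔸)ᶜᵒⁿᵗ`**: the homomorphism `φ = χ · l2Scaling : Mp_ψ(W_𝔸)ᶜᵒⁿᵗ →* ℂˣ`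
is `1` on `ker π = {(1, t·id)}` (§1: `(t t̄)⁻¹ · |t|² = 1`), so it factors through the surjection `π` onto `Sp(W_𝔸)`, a group
without characters (`Automorphic.AdeleRingSymplecticPerfect`). [cite: Kudla1994, Thm. 3.1] [cite: MoeglinVignerasWaldspurger1987, Chap. 2 II.1 (B)] -/
theorem doublingDefectChar_mul_l2Scaling_eq_one (x : adelicMpCont F (Fin n) T) :
    (doublingDefectChar F T hT x : ℂ) * ((adelicMpCont.l2Scaling F T hT ν x).toReal : ℂ) = 1 := by
  -- the `L²` scaling as a homomorphism into `ℂˣ` (in-proof; no definition)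
  let L : adelicMpCont F (Fin n) T →* ℂˣ := MonoidHom.mk'
    (fun x => Units.mk0 ((adelicMpCont.l2Scaling F T hT ν x).toReal : ℂ) (l2Scaling_toReal_ne_zero F T hT ν x))
    (fun x y => Units.ext ((congrArg (fun r : ℝ≥0∞ => ((r.toReal : ℝ) : ℂ)) (adelicMpCont.l2Scaling_mul F T hT ν x y)).trans
      (by rw [ENNReal.toReal_mul, Complex.ofReal_mul]; rfl)))
  have hL : ∀ y, ((L y : ℂˣ) : ℂ) = ((adelicMpCont.l2Scaling F T hT ν y).toReal : ℂ) := fun y => rfl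
  let φ : adelicMpCont F (Fin n) T →* ℂˣ := doublingDefectChar F T hT * L
  have hφ_apply : ∀ y, ((φ y : ℂˣ) : ℂ) =
      (doublingDefectChar F T hT y : ℂ) * ((adelicMpCont.l2Scaling F T hT ν y).toReal : ℂ) := fun y => rfl
  -- `φ` kills `ker π`: on `(1, t·id)` it is `(t t̄)⁻¹ · |t|² = 1`
  have hker : (adelicMpCont.proj F (Fin n) T).ker ≤ φ.ker := by
    intro z hz
    refine (adelicMpCont.exists_eq_ofScalar_of_proj_eq_one ((Matrix.isUnit_iff_isUnit_det T).mpr hT) z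
      ((MonoidHom.mem_ker).1 hz)).elim fun t hzt => ?_
    subst hzt
    refine (MonoidHom.mem_ker).2 (Units.ext ((hφ_apply _).trans ?_))
    have hn : (((‖(t : ℂ)‖ₑ ^ 2).toReal : ℝ) : ℂ) = (t : ℂ) * conj (t : ℂ) := by
      rw [ENNReal.toReal_pow, toReal_enorm, Complex.mul_conj, Complex.normSq_eq_norm_sq, Complex.ofReal_pow]
    refine ((congrArg₂ (fun (a : ℂ) (r : ℝ≥0∞) => a * ((r.toReal : ℝ) : ℂ)) (doublingDefectChar_ofScalar F T hT t)
      (l2Scaling_ofScalar F T hT ν t)).trans ?_)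
    rw [hn, Units.val_one]
    exact inv_mul_cancel₀ (mul_ne_zero t.ne_zero ((map_ne_zero _).2 t.ne_zero))
  -- hence it factors through `π` (surjective) and is trivial
  have hφ : φ = 1 :=
    monoidHom_eq_one_of_factors_through_symplecticGroup_adeleRing_gram F T hT (adelicMpCont.proj F (Fin n) T)
      ((adelicMpCont.proj F (Fin n) T).liftOfRightInverse (Function.surjInv (adelicMpCont.proj_surjective F T hT))
        (Function.rightInverse_surjInv (adelicMpCont.proj_surjective F T hT)) ⟨φ, hker⟩) φ
      ((adelicMpCont.proj F (Fin n) T).liftOfRightInverse_comp (Function.surjInv (adelicMpCont.proj_surjective F T hT))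
        (Function.rightInverse_surjInv (adelicMpCont.proj_surjective F T hT)) ⟨φ, hker⟩).symm
  have hx : φ x = 1 := (DFunLike.congr_fun hφ x).trans (MonoidHom.one_apply x)
  exact (hφ_apply x).symm.trans ((congrArg (fun u : ℂˣ => (u : ℂ)) hx).trans Units.val_one)

/-- **THE CLOSED FORM `χ(x) = (l2Scaling x)⁻¹`** for every `x ∈ Mp_ψ(W_𝔸)ᶜᵒⁿᵗ`: the defect of the doubling lift against
`ω(x) ⊠ conj ω(x)` is exactly the `L²`-non-unitarity of `ω(x)`. [cite: Kudla1994, Thm. 3.1] [cite: HarrisKudlaSweet1996, §1] -/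
theorem doublingDefectChar_coe_eq_inv_l2Scaling (x : adelicMpCont F (Fin n) T) :
    (doublingDefectChar F T hT x : ℂ) = ((adelicMpCont.l2Scaling F T hT ν x).toReal : ℂ)⁻¹ :=
  eq_inv_of_mul_eq_one_left (doublingDefectChar_mul_l2Scaling_eq_one F T hT ν x)

/-- **TRIVIALITY ON `L²`-ISOMETRIC IMPLEMENTERS**: `l2Scaling ν x = 1 ⇒ doublingDefectChar x = 1` — on the unitary part of
`Mp_ψ(W_𝔸)ᶜᵒⁿᵗ` the doubling lift restricted to the diagonal IS `ω ⊗ ω̄` ([Li1992, p. 181]; [Kudla1994, Thm. 3.1]: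
`χ_{W ⊕ W⁻}|_Δ = χ_W χ_W⁻¹ = 1`). [cite: Kudla1994, Thm. 3.1] [cite: Li1992, p. 181] -/
theorem doublingDefectChar_eq_one_of_l2Scaling_eq_one {x : adelicMpCont F (Fin n) T}
    (hx : adelicMpCont.l2Scaling F T hT ν x = 1) : doublingDefectChar F T hT x = 1 :=
  Units.ext ((doublingDefectChar_coe_eq_inv_l2Scaling F T hT ν x).trans
    (by rw [hx, ENNReal.toReal_one, Complex.ofReal_one, inv_one, Units.val_one]))

/-- **… in the `hiso` currency of the Rallis letters**: if `∫⁻ ‖ω(x)Φ‖ₑ² dν = ∫⁻ ‖Φ‖ₑ² dν` for all `Φ ∈ 𝒮(𝔸_Fⁿ)` then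
`doublingDefectChar x = 1` — the stub «SW0» of the E-2 Siegel–Weil sub-line reads `hiso (g, 1)` through this.
[cite: Kudla1994, Thm. 3.1] [cite: Li1992, p. 181] -/
theorem doublingDefectChar_eq_one_of_lintegral_eq {x : adelicMpCont F (Fin n) T}
    (hx : ∀ Φ : piSchwartzBruhat F (Fin n),
      ∫⁻ u, ‖((adelicMpCont.omega F (Fin n) T x Φ : piSchwartzBruhat F (Fin n)) :
          (Fin n → AdeleRing (𝓞 F) F) → ℂ) u‖ₑ ^ 2 ∂ν =
        ∫⁻ u, ‖(Φ : (Fin n → AdeleRing (𝓞 F) F) → ℂ) u‖ₑ ^ 2 ∂ν) :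
    doublingDefectChar F T hT x = 1 :=
  doublingDefectChar_eq_one_of_l2Scaling_eq_one F T hT ν
    (adelicMpCont.l2Scaling_eq_of_forall F T hT ν x fun Φ => (hx Φ).trans (one_mul _).symm)

end Trivial

end Literature.NumberTheory.Weil1964

end
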